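/-
COR-CM (cells pub-hodgecm / pub-hodgecm2, stage 2 of the Hodge ladder) — TRANSPOSITION SURGE, item (vi) sub-binder S2: the READING binder
`hComp` of own-htheta's pinned junction (tree `Transposition/Item6PinReach.lean` :233–242) DERIVED at the honest Appendix-C datum of TEAM
hComp (`Model.honestP5Of h`, package P2′: pin along `ῑ₁ := conj ∘ ι₁`) from TWO CITED THEOREMS AS PRINTED — Deligne's canonical model
(`h : UnitaryCanonicalModel.exists_recordSystem`, [Deligne 1979] 2.2.5 + Cor. 2.7.21 with 2.1.2) and Liu's Albanese base change
(`hA : Liu2021.albanese_baseChange_isLimit_fan_jacobian`, [Liu2021] §2.1 Prop. + Lemma 2.2 (1)) — plus Liu's POSITED §4.2 carriers `C`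
(`Sec42Data`: `Sh(𝕍)_K`, `X_K`, `A_K := Alb_{X_K}`) and the rest `R` of Thm. 4.18's data; and own-htheta's `hReach` at that pin.  Seat
prover-pub-hodgecm2-pin-1-g2-0 (pin-1 gen 2, owner of record of `hComp`;     ∀ (F : CMField), IsGalois ℚ F → 6 ≤ Module.finrank ℚ F → ∀ (Φ : CMType F) (ι₁ : F →+* ℂ), ι₁ ∈ Φ.1 →
    ∀ V : HermSpace3 F ι₁, ∃ Ksm : Subgroup (toThm418Data (C F ι₁ V Φ) (R F ι₁ V Φ)).G, IsOpenCompact Ksm ∧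
      ∀ K : Subgroup (toThm418Data (C F ι₁ V Φ) (R F ι₁ V Φ)).G, IsOpenCompact K → K ≤ Ksm →
        ∃ (Cset : Type) (_ : Fintype Cset) (X : Cset → SchemeOver ℂ) (B : ∀ c, UnitaryBallUniformisationDatum 2 (X c))
          (Γ : Cset → Level V) (𝒥 : ∀ c, Jacobian (X c))
          (π : ∀ c, (letI := ((starRingEnd ℂ).comp ι₁).toAlgebra; ((C F ι₁ V Φ).A ((C F ι₁ V Φ).levelOf K)).baseChange ℂ) ⟶ (𝒥 c).J),
          (∀ c, (B c).Hℂ = V.Hm.map ι₁) ∧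
          (∀ c, (B c).Γ.map (Matrix.GeneralLinearGroup.map (B c).τ₁) =
            (Γ c).Γ.map (Matrix.GeneralLinearGroup.map ι₁)) ∧
          Nonempty (IsLimit (Fan.mk (letI := ((starRingEnd ℂ).comp ι₁).toAlgebra; ((C F ι₁ V Φ).A ((C F ι₁ V Φ).levelOf K)).baseChange ℂ) π))-TABLE row U5 / `Closed`).  THEOREMS ONLY; nothing asserted;
nothing in the tree edited.  FRAMING: HC_CM is NOT proved.
-/
import Summits.HodgeConjecture.CorCM.B01.Transposition.Item6PinReachAlong
import Summits.HodgeConjecture.CorCM.B01.Transposition.HComp.HUnifHolds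
import Summits.HodgeConjecture.CorCM.B01.Transposition.HComp.HAlbHolds
import HarnessLib

/-!
# Item (vi) S2: `hComp` and `hReach` CLOSED at the honest Appendix-C datum, modulo two cited theorems

* `Model.hComp_holds (h) (hA) (iso) (C)` — the binder `hComp` of `Model.pinReach_of_componentPinC_along` at
  `e := fun F ι₁ => (starRingEnd ℂ).comp ι₁`, `P5 := Model.honestP5Of h`: `Model.hComp_of_unif_of_alb_along` (pin-1, Along §2) fed with
  `Model.hUnif_holds h` (pin-1, TEAM hComp U5: htheta-x1's canonical-model record, its pieces DERIVED by hcomp-compare-2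
  `HComp.RecordSystem.exists_pieces` over mc-binder-2's components, b25's honest datum + slot, hcomp-shimura carriers, hcomp-level levels)
  and `Model.hAlb_holds hA` (hcomp-abcm-1, A1/A1w).
* `Model.pinReach_closed (h₁ h₃) (h) (hA) (iso) (C) (R)` — own-htheta's `hReach` VERBATIM at `D := AppendixC.toThm418Data (C …) (R …)` and
  the pin `A_μ ⊗_{E,ῑ₁} ℂ := (letI := ((starRingEnd ℂ).comp ι₁).toAlgebra; ((R …).Aμ D_μ).baseChange ℂ)` — NO pin-1 binder left:
  the hypotheses are the two cited facts `h`, `hA`, Liu's carriers `iso`/`C`/`R`, and the universe records `h₁`/`h₃` (tree theorems at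
  the E term) needed to state the tree surface.
STRENGTH: unchanged from `Item6PinReach.lean` (class O at the E-rational pin; ⟹ B01-S with the Liu-side binders; no «↔ B01-S»).  What moved:
`homE`/`hE` (rfl, `Item6PinReachGlue.lean`), `hUnif` (theorem modulo `h`), `hAlb` (theorem modulo `hA`) — `hComp` is no longer a READING
binder but a consequence of two printed theorems on Liu's own carriers.  HC_CM is NOT proved: the S2 socket is inhabited only when the
consumer's END display (pin-3 / own-htheta lineage) is re-instantiated at `(honestP5Of h, ῑ₁)` with pin-2's `…_along` and the remaining
Liu-side binders (`hLiu`, `hObj`, `hChi`, `hirr`, `hsm`, `hμ`, `hCMisogE`, `hD`) — none of which is pin-1's.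
-/

noncomputable section

namespace Summit.HodgeConjecture.CorCM.Model

open CategoryTheory CategoryTheory.Limits AlgebraicGeometry NumberField
open Literature.AlgebraicGeometry.Motives
open Literature.AlgebraicGeometry.ShimuraVarieties
open Literature.AlgebraicGeometry.ShimuraVarieties.UnitaryCanonicalModel
open Literature.NumberTheory.Automorphic
open Literature.NumberTheory.Automorphic.PicardCM
open Literature.NumberTheory.Automorphic.Liu2021
open Literature.NumberTheory.Automorphic.Liu2021.AppendixC

/-- **`hComp` HOLDS at the honest datum** (`P5 := Model.honestP5Of h`, pin `ῑ₁ := conj ∘ ι₁`): the binder `hComp` of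
`Model.pinReach_of_componentPinC_along` token for token, from the cited facts `h : exists_recordSystem` ([Deligne 1979] 2.2.5 + Cor. 2.7.21,
2.1.2) and `hA : albanese_baseChange_isLimit_fan_jacobian` ([Liu2021] §2.1 Prop. l. 1190–1200 + Lemma 2.2 (1)), for the consumer's posited
§4.2 carriers `C` (Liu's `Sh(𝕍)_K`, `X_K`, `A_K := Alb_{X_K}` over the honest Prop-C.5 datum).  `hComp_of_unif_of_alb_along ∘ (hUnif_holds,
hAlb_holds)`.  HC_CM is NOT proved. [cite: Deligne1979ShimuraVarieties, §2.1.2, 2.2.5 and Cor. 2.7.21]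
[cite: Liu2021, §2.1 Proposition (FJcycle.tex l. 1190–1200) and Lemma 2.2 (1); Prop. C.5 l. 4627–4633; §4.2 l. 2060–2066] -/
theorem hComp_holds (h : exists_recordSystem) (hA : albanese_baseChange_isLimit_fan_jacobian)
    (iso : ∀ (F : CMField) (ι₁ : F →+* ℂ) (_ : HermSpace3 F ι₁) (_ : CMType F), ℕ → Prop)
    (C : ∀ (F : CMField) (ι₁ : F →+* ℂ) (V : HermSpace3 F ι₁) (Φ : CMType F), Sec42Data (honestP5Of h F ι₁ V Φ) (iso F ι₁ V Φ))
    (R : ∀ (F : CMField) (ι₁ : F →+* ℂ) (V : HermSpace3 F ι₁) (Φ : CMType F), Thm418Rest (C F ι₁ V Φ)) :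
    ∀ (F : CMField), IsGalois ℚ F → 6 ≤ Module.finrank ℚ F → ∀ (Φ : CMType F) (ι₁ : F →+* ℂ), ι₁ ∈ Φ.1 →
    ∀ V : HermSpace3 F ι₁, ∃ Ksm : Subgroup (toThm418Data (C F ι₁ V Φ) (R F ι₁ V Φ)).G, IsOpenCompact Ksm ∧
      ∀ K : Subgroup (toThm418Data (C F ι₁ V Φ) (R F ι₁ V Φ)).G, IsOpenCompact K → K ≤ Ksm →
        ∃ (Cset : Type) (_ : Fintype Cset) (X : Cset → SchemeOver ℂ) (B : ∀ c, UnitaryBallUniformisationDatum 2 (X c))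
          (Γ : Cset → Level V) (𝒥 : ∀ c, Jacobian (X c))
          (π : ∀ c, (letI := ((starRingEnd ℂ).comp ι₁).toAlgebra; ((C F ι₁ V Φ).A ((C F ι₁ V Φ).levelOf K)).baseChange ℂ) ⟶ (𝒥 c).J),
          (∀ c, (B c).Hℂ = V.Hm.map ι₁) ∧
          (∀ c, (B c).Γ.map (Matrix.GeneralLinearGroup.map (B c).τ₁) =
            (Γ c).Γ.map (Matrix.GeneralLinearGroup.map ι₁)) ∧
          Nonempty (IsLimit (Fan.mk (letI := ((starRingEnd ℂ).comp ι₁).toAlgebra; ((C F ι₁ V Φ).A ((C F ι₁ V Φ).levelOf K)).baseChange ℂ) π)) :=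
  hComp_of_unif_of_alb_along (fun _ ι₁ => (starRingEnd ℂ).comp ι₁) (honestP5Of h) iso C (hUnif_holds h)
    (hAlb_holds hA (fun _ ι₁ => (starRingEnd ℂ).comp ι₁) (honestP5Of h) iso C)

/-- **`hReach` CLOSED at the honest datum** (`U = picardCMUniverse hHD hI h₁ h₃`): own-htheta's binder `hReach` of
`Model.faceSupply_of_thm418AsPrinted_pinned` VERBATIM at `D F ι₁ V Φ := toThm418Data (C F ι₁ V Φ) (R F ι₁ V Φ)` over the honest datum
`honestP5Of h` and the pin `A_μ ⊗_{E,ῑ₁} ℂ`, from the cited facts `h` (Deligne) and `hA` (Liu §2.1), the consumer's posited carriers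
`iso`/`C`/`R` ([Liu2021] §4.2, Def. 4.5 (2)) and the universe records `h₁`/`h₃` (to state the tree surface `P_Γ(V)`).
`pinReach_of_componentPinC_along ∘ hComp_holds`.  HC_CM is NOT proved; no pin-1 binder remains in this statement.
[cite: Liu2021, Thm. 4.18 (1) (FJcycle.tex l. 2239), §4.2 l. 2060–2066, Def. 4.5 (2) l. 1944, Prop. C.5 l. 4627–4633, §2.1 Proposition and Lemma 2.2 (1)]
[cite: Deligne1979ShimuraVarieties, §2.1.2, 2.2.5 and Cor. 2.7.21] -/
theorem pinReach_closed
    (h₁ : BallQuotientUniformised) (h₃ : CMAbelianVarietyRealised)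
    (h : exists_recordSystem) (hA : albanese_baseChange_isLimit_fan_jacobian)
    (iso : ∀ (F : CMField) (ι₁ : F →+* ℂ) (_ : HermSpace3 F ι₁) (_ : CMType F), ℕ → Prop)
    (C : ∀ (F : CMField) (ι₁ : F →+* ℂ) (V : HermSpace3 F ι₁) (Φ : CMType F), Sec42Data (honestP5Of h F ι₁ V Φ) (iso F ι₁ V Φ))
    (R : ∀ (F : CMField) (ι₁ : F →+* ℂ) (V : HermSpace3 F ι₁) (Φ : CMType F), Thm418Rest (C F ι₁ V Φ)) :
    ∀ (F : CMField), IsGalois ℚ F → 6 ≤ Module.finrank ℚ F → ∀ (Φ : CMType F) (ι₁ : F →+* ℂ), ι₁ ∈ Φ.1 →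
      ∀ V : HermSpace3 F ι₁, ∃ Ksm : Subgroup (toThm418Data (C F ι₁ V Φ) (R F ι₁ V Φ)).G, IsOpenCompact Ksm ∧
        ∀ (K : Subgroup (toThm418Data (C F ι₁ V Φ) (R F ι₁ V Φ)).G) (Dμ : (toThm418Data (C F ι₁ V Φ) (R F ι₁ V Φ)).Obj)
          (φ : (toThm418Data (C F ι₁ V Φ) (R F ι₁ V Φ)).HomK K Dμ),
          IsOpenCompact K → K ≤ Ksm → φ ≠ 0 →
            ∃ (Γ : Level V) (𝒥 : Jacobian (Var.scheme (ballQuotientUniformisedDatum_of h₁) h₃ (.pms (pmsCode F ι₁ V Γ))))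
              (w : 𝒥.J ⟶ (letI := ((starRingEnd ℂ).comp ι₁).toAlgebra; ((R F ι₁ V Φ).Aμ Dμ).baseChange ℂ)), w ≠ 0 :=
  pinReach_of_componentPinC_along h₁ h₃ (fun _ ι₁ => (starRingEnd ℂ).comp ι₁) (honestP5Of h) iso C R (hComp_holds h hA iso C R)

end Summit.HodgeConjecture.CorCM.Model

end
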